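import Mathlib
import Summits.NavierStokesRegularity.NavierStokesRegularity.Theorems.FilamentSkeletonRssKelvinGateSharpLineApriori
import Summits.NavierStokesRegularity.NavierStokesRegularity.Theorems.FilamentSkeletonRssKelvinGateRotationKernel
import Summits.NavierStokesRegularity.NavierStokesRegularity.Theorems.FilamentSkeletonRssKelvinGateRotationDivFree

/-!
# Route `FilamentSkeletonRss` · crux `TransverseReduction1AG` (stmt-27853) — line `kelvin_gate_sharp`:
# THE ROTATION OBSTRUCTION — an un-bordered sharp a-priori bound is paid for by the ROTATION MODE of the base

Helper file (theorems + two `Prop` definitions, `--as helper`).  HONEST FRAMING: linear bookkeeping for a HYPOTHETICAL filament-type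
rotating-self-similar blow-up route (MODEL rung, negative side); nothing here bears on Navier–Stokes regularity; `TransverseReduction1AG` is
neither proved nor refuted.  What IS proved is a NEGATIVE structural fact about this lane's own estimate-form stub S2‴ (`EventualSharpApriori1AS`,
p642427): it is incompatible with a non-axisymmetric dressing, i.e. the un-bordered sharp line dies at the gate exactly as the frozen-base
column lines did under the tenure objection O1 — by the e₃-rotation symmetry of the profile equation.

Mechanism (all kernel-checked).  The profile equation `E_α(U) + ∇P = 0` is equivariant under rotations about `e₃`; differentiating,
`𝓛_(α,U⁰)(𝓡U⁰) + ∇(𝓡ₛP⁰) = 𝓡(E_α U⁰ + ∇P⁰)` for EVERY `C³/C²` pair (`lerayLin_rotField_add_gradient_rotScalar`, p-landed g6), where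
`𝓡V = e₃ × V − DV[e₃ × y]`, `𝓡ₛP = −DP[e₃ × y]`.  So the rotation mode `(𝓡U⁰, 𝓡ₛP⁰)` is a sharp solution of the linearised system whose datum
is the rotated RESIDUAL.  Hence:

* `SharpApriori.rotField_le` — if `SharpApriori a B α U⁰` holds and the rotated residual has `Y♯_a`-size `ε`, then `𝓡U⁰ ∈ X♯_a(Bε)`; in
  particular `(1+|y|)‖𝓡U⁰(y)‖ ≤ Bε` at every point: **the a-priori constant is at least (rotation mode)/(rotated residual)**;
* `SharpApriori.rotField_eq_zero_of_profile` — **at an EXACT profile, a sharp a-priori bound forces AXISYMMETRY** (`𝓡U = 0`): no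
  un-bordered sharp estimate (hence, with uniqueness, no un-bordered sharp gate of the kind `sharp_gate_of_apriori` builds) exists at a
  non-axisymmetric exact profile, for any constant;
* `not_eventualSharpApriori1AS_of_rotating_dressing` — STUB LEVEL: if A1G skeletons exist for some box at all large `Γ` (this is implied by the
  deciding ∃-crux `SkeletonJ1G`, but stated here as the weaker `SkeletonsEventually1AG`) and the dressing delivers, to every order `k`, sharp
  bases whose ROTATED residual is also `O(Γ^{-k})` in `Y♯` while their rotation mode keeps a polynomial floor `σΓ^{-s}` at some point
  (`RotatingDressing1AS` — what a dressed TILTED filament is), then `EventualSharpApriori1AS` is FALSE: its constant `B₀Γ^κ` is fixed before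
  the order `k`, but must exceed `σΓ^{-s}·Γ^{k}/C_r` for every `k`.
So the estimate-form line (p642427) cannot be completed as cut; the gate must be BORDERED by the rotation mode (line of record L3
`defect_column_gate_1AG`: compactly supported column `χ·𝓡U⁰_β` + re-wound family), to which the sharp toolkit (free gate, scale maps, closing,
continuity method, free/small-base a-priori bounds) transfers by name.
-/

set_option linter.dupNamespace false

noncomputable section

namespace Summit.NavierStokesRegularity.NavierStokesRegularity.Theorems.KelvinGate

open scoped BigOperators Topology InnerProductSpace RealInnerProductSpace ContDiff
open Filter Set Function MeasureTheory
open Literature.Analysis.FluidPDE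
open Summit.NavierStokesRegularity.NavierStokesRegularity.Theses.FilamentSkeletonRss

/-! ## 1. The rotation mode is paid by the rotated residual -/

/-- The rotated pressure `𝓡ₛP = −DP[e₃ × y]` of a `C²` scalar is `C¹`. -/
theorem contDiff_one_rotScalar {P : EuclideanSpace ℝ (Fin 3) → ℝ} (hP : ContDiff ℝ 2 P) :
    ContDiff ℝ 1 (fun z => -(fderiv ℝ P z) (cross (EuclideanSpace.single 2 1) z)) := by
  have hJ : ContDiff ℝ 1 (fun y : EuclideanSpace ℝ (Fin 3) => cross (EuclideanSpace.single 2 1) y) := by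
    simp only [cross_single_two_eq_rotGenL]; exact rotGenL.contDiff
  exact ((hP.fderiv_right (m := 1) le_rfl).clm_apply hJ).neg

/-- **THE A-PRIORI CONSTANT PAYS FOR THE ROTATION MODE.**  Let `SharpApriori a B α U⁰` hold at a base `U⁰ ∈ C³` (divergence free) with
pressure `P⁰ ∈ C²`, suppose the rotation mode `𝓡U⁰` is sharp X-bounded (any radius) and the rotated pressure `𝓡ₛP⁰` bounded, and let the
ROTATED RESIDUAL `𝓡(E_α U⁰ + ∇P⁰)` have `Y♯_a`-size `ε`.  Then `𝓡U⁰ ∈ X♯_a(B ε)`. -/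
theorem SharpApriori.rotField_le {a B α : ℝ} {U0 : EuclideanSpace ℝ (Fin 3) → EuclideanSpace ℝ (Fin 3)}
    {P0 : EuclideanSpace ℝ (Fin 3) → ℝ} (hap : SharpApriori a B α U0) (hU : ContDiff ℝ 3 U0)
    (hdiv : VectorCalculus.IsDivFree U0) (hP : ContDiff ℝ 2 P0) {ρ Mq ε : ℝ}
    (hrotX : XSharp a (fun z => cross (EuclideanSpace.single 2 1) (U0 z) - fderiv ℝ U0 z (cross (EuclideanSpace.single 2 1) z)) ρ)
    (hrotP : ∀ y, |-(fderiv ℝ P0 y) (cross (EuclideanSpace.single 2 1) y)| ≤ Mq)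
    (hres : YSharp a (fun y => cross (EuclideanSpace.single 2 1) (lerayOp α U0 y + gradient P0 y) -
      fderiv ℝ (fun z => lerayOp α U0 z + gradient P0 z) y (cross (EuclideanSpace.single 2 1) y)) ε) :
    XSharp a (fun z => cross (EuclideanSpace.single 2 1) (U0 z) - fderiv ℝ U0 z (cross (EuclideanSpace.single 2 1) z)) (B * ε) :=
  hap _ _ _ ε ⟨ρ, hrotX⟩ (IsDivFree.rotField (hU.of_le (by norm_num)) hdiv) (contDiff_one_rotScalar hP) ⟨Mq, hrotP⟩ hres
    (fun y => lerayLin_rotField_add_gradient_rotScalar α hU hP y)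

/-- Pointwise form: under the same hypotheses, `(1 + |y|)·‖𝓡U⁰(y)‖ ≤ B ε` at every point — the constant of an un-bordered sharp
a-priori bound is at least `(1+|y|)‖𝓡U⁰(y)‖ / ε` (rotation mode over rotated residual). -/
theorem SharpApriori.weight_rotField_le {a B α : ℝ} {U0 : EuclideanSpace ℝ (Fin 3) → EuclideanSpace ℝ (Fin 3)}
    {P0 : EuclideanSpace ℝ (Fin 3) → ℝ} (hap : SharpApriori a B α U0) (hU : ContDiff ℝ 3 U0)
    (hdiv : VectorCalculus.IsDivFree U0) (hP : ContDiff ℝ 2 P0) {ρ Mq ε : ℝ}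
    (hrotX : XSharp a (fun z => cross (EuclideanSpace.single 2 1) (U0 z) - fderiv ℝ U0 z (cross (EuclideanSpace.single 2 1) z)) ρ)
    (hrotP : ∀ y, |-(fderiv ℝ P0 y) (cross (EuclideanSpace.single 2 1) y)| ≤ Mq)
    (hres : YSharp a (fun y => cross (EuclideanSpace.single 2 1) (lerayOp α U0 y + gradient P0 y) -
      fderiv ℝ (fun z => lerayOp α U0 z + gradient P0 z) y (cross (EuclideanSpace.single 2 1) y)) ε) (y : EuclideanSpace ℝ (Fin 3)) :
    (1 + ‖y‖) * ‖cross (EuclideanSpace.single 2 1) (U0 y) - fderiv ℝ U0 y (cross (EuclideanSpace.single 2 1) y)‖ ≤ B * ε :=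
  ((hap.rotField_le hU hdiv hP hrotX hrotP hres).2 y).1

/-- **AT AN EXACT PROFILE, A SHARP A-PRIORI BOUND FORCES AXISYMMETRY.**  If `(U, P)` solves the profile equation `E_α(U) + ∇P = 0`
exactly (`U ∈ C³` divergence free, `P ∈ C²`, rotation mode sharp X-bounded, rotated pressure bounded) and `SharpApriori a B α U` holds for
some `B`, then `𝓡U = 0`: the profile is infinitesimally axisymmetric about `e₃`.  Contrapositive: at a NON-axisymmetric exact profile no
un-bordered sharp a-priori bound exists, for any constant — the rotation mode is an honest kernel vector in the sharp class. -/
theorem SharpApriori.rotField_eq_zero_of_profile {a B α : ℝ} {U : EuclideanSpace ℝ (Fin 3) → EuclideanSpace ℝ (Fin 3)}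
    {P : EuclideanSpace ℝ (Fin 3) → ℝ} (hap : SharpApriori a B α U) (hU : ContDiff ℝ 3 U)
    (hdiv : VectorCalculus.IsDivFree U) (hP : ContDiff ℝ 2 P) {ρ Mq : ℝ}
    (hrotX : XSharp a (fun z => cross (EuclideanSpace.single 2 1) (U z) - fderiv ℝ U z (cross (EuclideanSpace.single 2 1) z)) ρ)
    (hrotP : ∀ y, |-(fderiv ℝ P y) (cross (EuclideanSpace.single 2 1) y)| ≤ Mq)
    (hprof : ∀ y, lerayOp α U y + gradient P y = 0) :
    (fun z => cross (EuclideanSpace.single 2 1) (U z) - fderiv ℝ U z (cross (EuclideanSpace.single 2 1) z)) = fun _ => 0 := by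
  have hzero : (fun z => lerayOp α U z + gradient P z) = fun _ => 0 := funext hprof
  have hres : YSharp a (fun y => cross (EuclideanSpace.single 2 1) (lerayOp α U y + gradient P y) -
      fderiv ℝ (fun z => lerayOp α U z + gradient P z) y (cross (EuclideanSpace.single 2 1) y)) 0 := by
    have e : (fun y => cross (EuclideanSpace.single 2 1) (lerayOp α U y + gradient P y) -
        fderiv ℝ (fun z => lerayOp α U z + gradient P z) y (cross (EuclideanSpace.single 2 1) y)) =
        fun _ => (0 : EuclideanSpace ℝ (Fin 3)) := by
      funext y
      rw [hprof y, hzero]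
      simp only [cross_single_two_eq_rotGenL, map_zero, fderiv_fun_const, Pi.zero_apply, zero_apply, sub_zero]
    rw [e]; exact ySharp_zero
  have h := hap.rotField_le hU hdiv hP hrotX hrotP hres
  rw [mul_zero] at h
  exact h.eq_zero_of_nonpos le_rfl

/-! ## 2. Stub level: a rotating dressing kills the estimate-form stub -/

/-- **A1G skeletons exist for SOME box at arbitrarily large `Γ`** (with the defining fields `u, v, A, T` realised).  This is what the
refutation below needs from the ∃-side; it follows from the deciding crux `SkeletonJ1G` (`skeletonsEventually1AG_of_skeletonJ1G`). -/
def SkeletonsEventually1AG : Prop :=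
  ∃ (N:ℕ) (δ ρ K Λ a b cnd η Rw Rb cg θ₀ KA : ℝ), 0 < N ∧ 0 < δ ∧ 0 < ρ ∧ 0 ≤ a ∧ 0 < η ∧ 0 < Rw ∧ 0 < Rb ∧ 0 < cg ∧ 0 < θ₀ ∧
    ∀ Γ₀ : ℝ, ∃ Γ : ℝ, Γ₀ ≤ Γ ∧ ∃ (γ:Fin N → ℝ) (α:ℝ) (X:Fin N → ℝ → EuclideanSpace ℝ (Fin 3)) (w:Fin N → ℝ → ℝ) (c:Fin N → ℝ)
      (m n:Fin N → EuclideanSpace ℝ (Fin 3)) (Aa:Fin N → ℝ → ℝ) (u:(Fin N → ℝ → EuclideanSpace ℝ (Fin 3)) → EuclideanSpace ℝ (Fin 3) → EuclideanSpace ℝ (Fin 3))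
      (v:EuclideanSpace ℝ (Fin 3) → EuclideanSpace ℝ (Fin 3)) (A:Fin N → (EuclideanSpace ℝ (Fin 3) →L[ℝ] EuclideanSpace ℝ (Fin 3)))
      (T:(Fin N → ℝ → EuclideanSpace ℝ (Fin 3)) → Fin N → ℝ → EuclideanSpace ℝ (Fin 3)),
      DefU1A N Γ γ Aa u ∧ DefV1A N α X u v ∧ DefA1A N X c v A ∧ DefT1A N α u T ∧
      Clauses1AG N Γ δ ρ K Λ a b cnd Rw Rb cg θ₀ KA γ α X w c m n Aa v A T

/-- The deciding ∃-crux `SkeletonJ1G` gives `SkeletonsEventually1AG` (realise `u, v, A, T` by their defining formulas). [folklore] -/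
theorem skeletonsEventually1AG_of_skeletonJ1G (h : SkeletonJ1G) : SkeletonsEventually1AG := by
  obtain ⟨N, δ, ρ, K, Λ, a, b, cnd, η, Rw, Rb, cg, θ₀, KA, Γ₂, hN, hδ, hρ, ha, -, hη, hRw, hRb, hcg, hθ₀, hΓ⟩ := h
  refine ⟨N, δ, ρ, K, Λ, a, b, cnd, η, Rw, Rb, cg, θ₀, KA, hN, hδ, hρ, ha, hη, hRw, hRb, hcg, hθ₀, fun Γ₀ => ?_⟩
  refine ⟨max Γ₀ Γ₂, le_max_left _ _, ?_⟩
  obtain ⟨γ, α, X, w, c, m, n, Aa, hsk⟩ := hΓ (max Γ₀ Γ₂) (le_max_right _ _)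
  -- realise the defining fields
  let u : (Fin N → ℝ → EuclideanSpace ℝ (Fin 3)) → EuclideanSpace ℝ (Fin 3) → EuclideanSpace ℝ (Fin 3) := fun Z y =>
    ∑ k, ((max Γ₀ Γ₂)*γ k/(4*Real.pi))•∫ σ:ℝ, ((‖y-Z k σ‖^2+Real.exp (-(1+Real.eulerMascheroniConstant-Real.log 2))*Aa k σ)^(3/2:ℝ))⁻¹•
      cross (deriv (Z k) σ) (y-Z k σ)
  let v : EuclideanSpace ℝ (Fin 3) → EuclideanSpace ℝ (Fin 3) := fun y => u X y+(1/2:ℝ)•y-α•cross (EuclideanSpace.single 2 1) y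
  let A : Fin N → (EuclideanSpace ℝ (Fin 3) →L[ℝ] EuclideanSpace ℝ (Fin 3)) := fun j => fderiv ℝ v (X j (c j))
  let T : (Fin N → ℝ → EuclideanSpace ℝ (Fin 3)) → Fin N → ℝ → EuclideanSpace ℝ (Fin 3) := fun Z j τ =>
    (u Z (Z j τ)+(1/2:ℝ)•Z j τ-α•cross (EuclideanSpace.single 2 1) (Z j τ))-
      (⟪u Z (Z j τ)+(1/2:ℝ)•Z j τ-α•cross (EuclideanSpace.single 2 1) (Z j τ), deriv (Z j) τ⟫_ℝ/‖deriv (Z j) τ‖^2)•deriv (Z j) τ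
  have hu : DefU1A N (max Γ₀ Γ₂) γ Aa u := fun _ _ => rfl
  have hv : DefV1A N α X u v := fun _ => rfl
  have hA : DefA1A N X c v A := fun _ => rfl
  have hT : DefT1A N α u T := fun _ _ _ => rfl
  exact ⟨γ, α, X, w, c, m, n, Aa, u, v, A, T, hu, hv, hA, hT, hsk u v A T hu hv hA hT⟩

/-- **Rotating dressing** (what a dressed TILTED filament delivers): as `DressedBase1AS`, plus — for every order `k` — `U⁰ ∈ C³`, `P⁰ ∈ C²`,
sharp X-bounded rotation mode, bounded rotated pressure, the ROTATED residual `𝓡(E_{α₁}U⁰ + ∇P⁰)` also of `Y♯`-size `C_rΓ^{-k}`, and a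
Γ-polynomial FLOOR for the rotation mode at some point: `σΓ^{-s} ≤ (1+|y₁|)‖𝓡U⁰(y₁)‖` (`σ > 0`, `s` fixed with the box). -/
def RotatingDressing1AS : Prop :=
  ∀ (N:ℕ) (δ ρ K Λ a b cnd η Rw Rb cg θ₀ KA:ℝ), 0 < N → 0 < δ → 0 < ρ → 0 ≤ a → 0 < η → 0 < Rw → 0 < Rb → 0 < cg → 0 < θ₀ →
    ∃ Cb cb σ s : ℝ, 0 < σ ∧ ∀ k : ℕ, ∃ Cr Γ₁ : ℝ, ∀ Γ:ℝ, Γ₁≤Γ → ∀ (γ:Fin N → ℝ) (α:ℝ) (X:Fin N → ℝ → EuclideanSpace ℝ (Fin 3))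
      (w:Fin N → ℝ → ℝ) (c:Fin N → ℝ) (m n:Fin N → EuclideanSpace ℝ (Fin 3)) (Aa:Fin N → ℝ → ℝ)
      (u:(Fin N → ℝ → EuclideanSpace ℝ (Fin 3)) → EuclideanSpace ℝ (Fin 3) → EuclideanSpace ℝ (Fin 3))
      (v:EuclideanSpace ℝ (Fin 3) → EuclideanSpace ℝ (Fin 3)) (A:Fin N → (EuclideanSpace ℝ (Fin 3) →L[ℝ] EuclideanSpace ℝ (Fin 3)))
      (T:(Fin N → ℝ → EuclideanSpace ℝ (Fin 3)) → Fin N → ℝ → EuclideanSpace ℝ (Fin 3)),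
      DefU1A N Γ γ Aa u → DefV1A N α X u v → DefA1A N X c v A → DefT1A N α u T →
      Clauses1AG N Γ δ ρ K Λ a b cnd Rw Rb cg θ₀ KA γ α X w c m n Aa v A T →
      ∃ (α₁ : ℝ) (U0 : EuclideanSpace ℝ (Fin 3) → EuclideanSpace ℝ (Fin 3)) (P0 : EuclideanSpace ℝ (Fin 3) → ℝ),
        BaseSpec1AS k Cb cb Cr N Γ ρ η Rw X u α₁ U0 P0 ∧ ContDiff ℝ 3 U0 ∧ ContDiff ℝ 2 P0 ∧
        (∃ ρ₁, XSharp (3/2:ℝ) (fun z => cross (EuclideanSpace.single 2 1) (U0 z) - fderiv ℝ U0 z (cross (EuclideanSpace.single 2 1) z)) ρ₁) ∧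
        (∃ Mq, ∀ y, |-(fderiv ℝ P0 y) (cross (EuclideanSpace.single 2 1) y)| ≤ Mq) ∧
        YSharp (3/2:ℝ) (fun y => cross (EuclideanSpace.single 2 1) (lerayOp α₁ U0 y + gradient P0 y) -
          fderiv ℝ (fun z => lerayOp α₁ U0 z + gradient P0 z) y (cross (EuclideanSpace.single 2 1) y)) (Cr * Γ ^ (-(k:ℝ))) ∧
        ∃ y₁, σ * Γ ^ (-s) ≤ (1 + ‖y₁‖) * ‖cross (EuclideanSpace.single 2 1) (U0 y₁) - fderiv ℝ U0 y₁ (cross (EuclideanSpace.single 2 1) y₁)‖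

/-- A rotating dressing is in particular a sharp dressing (`RotatingDressing1AS → DressedBase1AS`). [folklore] -/
theorem dressedBase1AS_of_rotating (h : RotatingDressing1AS) : DressedBase1AS := by
  intro N δ ρ K Λ a b cnd η Rw Rb cg θ₀ KA hN hδ hρ ha hη hRw hRb hcg hθ₀
  obtain ⟨Cb, cb, σ, s, -, hS⟩ := h N δ ρ K Λ a b cnd η Rw Rb cg θ₀ KA hN hδ hρ ha hη hRw hRb hcg hθ₀
  refine ⟨Cb, cb, fun k => ?_⟩
  obtain ⟨Cr, Γ₁, hS'⟩ := hS k
  refine ⟨Cr, Γ₁, fun Γ hΓ γ α X w c m n Aa u v A T hu hv hA hT hcl => ?_⟩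
  obtain ⟨α₁, U0, P0, hb, -⟩ := hS' Γ hΓ γ α X w c m n Aa u v A T hu hv hA hT hcl
  exact ⟨α₁, U0, P0, hb⟩

/-- **THE ESTIMATE-FORM STUB IS INCOMPATIBLE WITH A ROTATING DRESSING.**  If A1G skeletons exist for some box at all large `Γ` and the
dressing is ROTATING (non-axisymmetric with a polynomial floor, rotated residual also `O(Γ^{-k})`), then `EventualSharpApriori1AS` is FALSE:
at `t = 1` its bound `B₀Γ^κ` — fixed before the order `k` — must satisfy `σΓ^{-s} ≤ B₀Γ^κ·C_rΓ^{-k}` (`SharpApriori.weight_rotField_le`) for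
every `k ≥ k₀` and all large `Γ`; take `k > κ + s + 1`. -/
theorem not_eventualSharpApriori1AS_of_rotating_dressing (hsk : SkeletonsEventually1AG) (hrot : RotatingDressing1AS) :
    ¬ EventualSharpApriori1AS := by
  intro hap
  obtain ⟨N, δ, ρ, K, Λ, a, b, cnd, η, Rw, Rb, cg, θ₀, KA, hN, hδ, hρ, ha, hη, hRw, hRb, hcg, hθ₀, hskel⟩ := hsk
  obtain ⟨Cb, cb, σ, s, hσ, hdress⟩ := hrot N δ ρ K Λ a b cnd η Rw Rb cg θ₀ KA hN hδ hρ ha hη hRw hRb hcg hθ₀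
  obtain ⟨κ, B₀, k₀, hS⟩ := hap N δ ρ K Λ a b cnd η Rw Rb cg θ₀ KA hN hδ hρ ha hη hRw hRb hcg hθ₀ Cb cb
  -- the order: `k ≥ k₀`, `k ≥ κ + s + 1`
  set k : ℕ := max k₀ (⌈κ + s⌉₊ + 1) with hk
  have hk₀ : k₀ ≤ k := le_max_left _ _
  have hk1 : κ + s + 1 ≤ (k : ℝ) := by
    have h1 : ((⌈κ + s⌉₊ + 1 : ℕ) : ℝ) ≤ (k : ℝ) := by exact_mod_cast le_max_right k₀ (⌈κ + s⌉₊ + 1)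
    push_cast at h1
    linarith [Nat.le_ceil (κ + s)]
  obtain ⟨Cr, Γ₁, hdress'⟩ := hdress k
  obtain ⟨Γ₂, hS'⟩ := hS k hk₀ Cr
  -- a skeleton at a large `Γ`
  obtain ⟨Γ, hΓ, γ, α, X, w, c, m, n, Aa, u, v, A, T, hu, hv, hA, hT, hcl⟩ :=
    hskel (max (max Γ₁ Γ₂) (max 1 (|B₀| * |Cr| / σ + 1)))
  have hΓ₁ : Γ₁ ≤ Γ := le_trans (le_trans (le_max_left _ _) (le_max_left _ _)) hΓ
  have hΓ₂ : Γ₂ ≤ Γ := le_trans (le_trans (le_max_right _ _) (le_max_left _ _)) hΓ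
  have hΓ1 : 1 ≤ Γ := le_trans (le_trans (le_max_left _ _) (le_max_right _ _)) hΓ
  have hΓbig : |B₀| * |Cr| / σ + 1 ≤ Γ := le_trans (le_trans (le_max_right _ _) (le_max_right _ _)) hΓ
  have hΓ0 : 0 < Γ := by linarith
  -- the rotating dressed base at this skeleton
  obtain ⟨α₁, U0, P0, hbS, hU3, hP2, ⟨ρ₁, hrotX⟩, ⟨Mq, hrotP⟩, hres, ⟨y₁, hfloor⟩⟩ :=
    hdress' Γ hΓ₁ γ α X w c m n Aa u v A T hu hv hA hT hcl
  -- the a-priori bound at `t = 1`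
  have hap1 := hS' Γ hΓ₂ γ α X w c m n Aa u v A T hu hv hA hT hcl α₁ U0 P0 hbS 1 ⟨zero_le_one, le_refl _⟩
  have e1 : (fun z => (1:ℝ) • U0 z) = U0 := by funext z; rw [one_smul]
  rw [e1] at hap1
  have hdivU : VectorCalculus.IsDivFree U0 := hbS.1.2.2.1
  -- rotation mode ≤ bound × rotated residual
  have hpt := hap1.weight_rotField_le hU3 hdivU hP2 hrotX hrotP hres y₁
  -- `σ Γ^{-s} ≤ B₀ Γ^κ · C_r Γ^{-k} ≤ |B₀||C_r| Γ^{κ - k} ≤ |B₀||C_r| Γ^{-s-1}`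
  have hchain : σ * Γ ^ (-s) ≤ |B₀| * |Cr| * Γ ^ (κ - (k:ℝ)) := by
    refine hfloor.trans (hpt.trans ?_)
    have e : B₀ * Γ ^ κ * (Cr * Γ ^ (-(k:ℝ))) = (B₀ * Cr) * (Γ ^ κ * Γ ^ (-(k:ℝ))) := by ring
    rw [e, ← Real.rpow_add hΓ0, ← sub_eq_add_neg]
    exact mul_le_mul_of_nonneg_right (by rw [← abs_mul]; exact le_abs_self _) (Real.rpow_nonneg hΓ0.le _)
  have hexp : Γ ^ (κ - (k:ℝ)) ≤ Γ ^ (-s - 1) := Real.rpow_le_rpow_of_exponent_le hΓ1 (by linarith)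
  have hchain2 : σ * Γ ^ (-s) ≤ |B₀| * |Cr| * Γ ^ (-s - 1) :=
    hchain.trans (mul_le_mul_of_nonneg_left hexp (by positivity))
  -- multiply by `Γ^{s+1} > 0`: `σ Γ ≤ |B₀||C_r|`
  have hsplit1 : Γ ^ (-s) * Γ ^ (s + 1) = Γ := by
    rw [← Real.rpow_add hΓ0]; norm_num
  have hsplit2 : Γ ^ (-s - 1) * Γ ^ (s + 1) = 1 := by
    rw [← Real.rpow_add hΓ0]; norm_num
  have hpos : 0 < Γ ^ (s + 1) := Real.rpow_pos_of_pos hΓ0 _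
  have hfin : σ * Γ ≤ |B₀| * |Cr| := by
    have := mul_le_mul_of_nonneg_right hchain2 hpos.le
    rw [mul_assoc, hsplit1, mul_assoc, hsplit2, mul_one] at this
    exact this
  -- but `Γ > |B₀||C_r|/σ`
  have hcontra : |B₀| * |Cr| < σ * Γ := by
    have h1 : |B₀| * |Cr| / σ < Γ := by linarith
    have := (div_lt_iff₀ hσ).mp h1
    linarith [this]
  linarith

/-- **COROLLARY (the deciding ∃-crux version).**  `SkeletonJ1G → RotatingDressing1AS → ¬ EventualSharpApriori1AS`: on the A1G cone, a
rotating dressing and the un-bordered estimate stub cannot both hold. -/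
theorem not_eventualSharpApriori1AS_of_skeletonJ1G (hsk : SkeletonJ1G) (hrot : RotatingDressing1AS) : ¬ EventualSharpApriori1AS :=
  not_eventualSharpApriori1AS_of_rotating_dressing (skeletonsEventually1AG_of_skeletonJ1G hsk) hrot

end Summit.NavierStokesRegularity.NavierStokesRegularity.Theorems.KelvinGate

end
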